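import Summits.Ventures.PercRepro.ProfilePointedColoop
import Summits.Ventures.PercRepro.ProfilePointedCaptured

/-!
# PercRepro — THE POINTED CONJECTURE (Ĉ) IS CLOSED UNDER ADDING A COLOOP: MINIMAL WITNESSES ARE COLOOP-FREE
(p10, gen 22; `proofs/P10-COLOOPEXT-g22.md`)

`PointedRow` (ProfilePointedAverage) is the pointed conjecture (Ĉ): `(N − k − 1)·P_k ≤ k·P_{k+1} + (N − 2k − 1)·c^p_k`
for `2k + 2 ≤ N`, with `P_k = #biIndepSets M k` and `c^p_k = extCount M k p`.  Let `e ≠ p` be a COLOOP of `M`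
(`ρ(E ∖ e) + 1 = ρ(E)`, the lane's convention) and `M' = M ∖ e` on `N − 1` elements.  The bi-independent sets of
`M` split by `e ∈ X` into `BI_k(M')` and `BI_{k−1}(M') + e` (`card_biIndepSets_coloop`, gen 13):
`P_k(M) = P_k(M') + P_{k−1}(M')`.  THIS FILE proves the same split for the extension counts,

  `c^p_k(M) = c^p_k(M') + c^p_{k−1}(M')`                                        (`extCount_delete_coloop`)

— a coloop never decides whether `p` is spanned (`mem_clF_insert_coloop_iff`: `p ∈ cl (X ∪ e) ↔ p ∈ cl X`) — and then
(Ĉ) at `(M, p, k)` is the SUM of (Ĉ) at `(M', p, k − 1)` and at `(M', p, k)`, plus `c^p_{k−1}(M') ≤ c^p_k(M')`, the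
monotonicity of the extension counts under the named fact (`extCount_mono_of_fact`, gen 15); at the boundary
`2k + 2 = N` the level-`k` instance of `M'` lies outside its window and the symmetry `P_k(M') = P_{k+1}(M')` replaces
it (`pointedRow_of_delete_coloop_of_fact`).  Hence (`pointedRowAt_of_delete_coloop_of_fact`): (Ĉ) at every level of
`(M ∖ e, p)` gives (Ĉ) at every level of `(M, p)` — CONDITIONAL on the named fact `BiIndepDensityLogConcave`
(Theorem A, Brändén–Huh), like every (Ĉ)-instance of the lane; everything else here is unconditional.

CONSEQUENCE (with `pointedRow_coloop_of_fact`, gen 13, for `p` itself a coloop): a (Ĉ)-witness `(M, p)` with a coloop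
has a (Ĉ)-witness `(M ∖ e, p)` on fewer elements — modulo Theorem A, the conjecture (Ĉ) is EQUIVALENT to its restriction
to coloop-free matroids, and no direct sum `M ⊕ U_{c,c}` (the census families of gens 14–21) can refute it unless `M`
already does.  Nothing here asserts (Ĉ).
-/

open scoped Matroid

namespace PercRepro.Cogirth

open Finset ThmH Skew

variable {α : Type} [DecidableEq α] {M : Matroid α} [M.Finite]

/-! ### A coloop never decides capture -/

/-- For a coloop `e`, a point `p ≠ e` and a set `X` avoiding `e`: `p ∈ cl (X ∪ e) ↔ p ∈ cl X`. -/
theorem mem_clF_insert_coloop_iff {e p : α} (he : e ∈ gr M) (hec : rk M ((gr M).erase e) + 1 = rk M (gr M))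
    (hp : p ∈ gr M) (hpe : p ≠ e) {X : Finset α} (hX : X ⊆ gr M) (heX : e ∉ X) :
    p ∈ clF M (insert e X) ↔ p ∈ clF M X := by
  have hepX : e ∉ insert p X := by
    simp only [mem_insert, not_or]
    exact ⟨fun h => hpe h.symm, heX⟩
  rw [mem_clF_iff_rk_insert_eq hp (insert_subset he hX), mem_clF_iff_rk_insert_eq hp hX, insert_comm p e X,
    rk_insert_of_coloop' he hec (insert_subset hp hX) hepX, rk_insert_of_coloop' he hec hX heX]
  constructor
  · intro h; omega
  · intro h; omega

/-- For `Z` avoiding `e` and `p ≠ e`: `p ∈ cl_{M ∖ e} Z ↔ p ∈ cl_M Z` (ranks in the deletion are ranks in `M`). -/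
theorem mem_clF_delete_iff {e p : α} (hp : p ∈ gr M) (hpe : p ≠ e) {Z : Finset α} (hZ : Z ⊆ (gr M).erase e) :
    p ∈ clF (M ＼ ({e} : Set α)) Z ↔ p ∈ clF M Z := by
  have hpe' : p ∈ (gr M).erase e := mem_erase.2 ⟨hpe, hp⟩
  have hp' : p ∈ gr (M ＼ ({e} : Set α)) := by rw [gr_delete']; exact hpe'
  have hZ' : Z ⊆ gr (M ＼ ({e} : Set α)) := by rw [gr_delete']; exact hZ
  rw [mem_clF_iff_rk_insert_eq hp' hZ', mem_clF_iff_rk_insert_eq hp (hZ.trans (erase_subset _ _)),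
    rk_delete hZ, rk_delete (insert_subset hpe' hZ)]

/-! ### The bi-independent sets through a coloop, as memberships -/

/-- For a coloop `e` and a bi-independent `k`-set `X ∋ e` of `M`, `X ∖ e` is a bi-independent `(k − 1)`-set of
`M ∖ e` (the forward map of `card_filter_biIndepSets_mem_coloop`, as a membership statement). -/
theorem erase_mem_biIndepSets_delete_of_coloop {e : α} (he : e ∈ gr M)
    (hec : rk M ((gr M).erase e) + 1 = rk M (gr M)) {k : ℕ} {X : Finset α} (hX : X ∈ biIndepSets M k)
    (heX : e ∈ X) : X.erase e ∈ biIndepSets (M ＼ ({e} : Set α)) (k - 1) := by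
  rw [mem_biIndepSets] at hX
  obtain ⟨hXg, hXk, hXr, hXc⟩ := hX
  rw [mem_biIndepSets, gr_delete']
  have hXg' : X.erase e ⊆ (gr M).erase e := erase_subset_erase e hXg
  refine ⟨hXg', by rw [card_erase_of_mem heX, hXk], ?_, ?_⟩
  · rw [rk_delete hXg']
    have h := rk_insert_of_coloop' he hec ((erase_subset _ _).trans hXg) (notMem_erase e X)
    rw [insert_erase heX, hXr] at h
    rw [card_erase_of_mem heX]
    omega
  · rw [rk_delete sdiff_subset]
    have e' : (gr M).erase e \ X.erase e = gr M \ X := by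
      ext x
      simp only [mem_sdiff, mem_erase]
      constructor
      · rintro ⟨⟨hxe, hx⟩, hxX⟩
        exact ⟨hx, fun h => hxX ⟨hxe, h⟩⟩
      · rintro ⟨hx, hxX⟩
        exact ⟨⟨fun h => hxX (h ▸ heX), hx⟩, fun h => hxX h.2⟩
    rw [e']
    exact hXc

/-- For a coloop `e` and a bi-independent `(k − 1)`-set `Y` of `M ∖ e` (`k ≥ 1`), `Y ∪ e` is a bi-independent
`k`-set of `M`. -/
theorem insert_mem_biIndepSets_of_coloop {e : α} (he : e ∈ gr M)
    (hec : rk M ((gr M).erase e) + 1 = rk M (gr M)) {k : ℕ} (hk : 1 ≤ k) {Y : Finset α}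
    (hY : Y ∈ biIndepSets (M ＼ ({e} : Set α)) (k - 1)) : insert e Y ∈ biIndepSets M k := by
  rw [mem_biIndepSets, gr_delete'] at hY
  obtain ⟨hYg', hYk, hYr, hYc⟩ := hY
  have heY : e ∉ Y := fun h => (mem_erase.1 (hYg' h)).1 rfl
  have hYg : Y ⊆ gr M := fun x hx => (mem_erase.1 (hYg' hx)).2
  rw [mem_biIndepSets]
  refine ⟨insert_subset he hYg, by rw [card_insert_of_notMem heY, hYk]; omega, ?_, ?_⟩
  · rw [rk_insert_of_coloop' he hec hYg heY, card_insert_of_notMem heY, ← rk_delete hYg', hYr]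
  · rw [rk_delete sdiff_subset] at hYc
    have e' : gr M \ insert e Y = (gr M).erase e \ Y := by
      ext x
      simp only [mem_sdiff, mem_insert, mem_erase, not_or]
      tauto
    rw [e']
    exact hYc

/-! ### The extension counts split at a coloop -/

/-- **THE EXTENSION COUNTS SPLIT AT A COLOOP**: for a coloop `e ≠ p` and `k ≥ 1`,
`c^p_k(M) = c^p_k(M ∖ e) + c^p_{k−1}(M ∖ e)` — the `e`-avoiding extendable sets are those of `M ∖ e`, and
`X ↦ X ∖ e` maps the ones through `e` onto the extendable `(k − 1)`-sets of `M ∖ e` (capture is unchanged by the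
coloop, `mem_clF_insert_coloop_iff`). -/
theorem extCount_delete_coloop {e p : α} (he : e ∈ gr M) (hec : rk M ((gr M).erase e) + 1 = rk M (gr M))
    (hp : p ∈ gr M) (hpe : p ≠ e) {k : ℕ} (hk : 1 ≤ k) :
    extCount M k p = extCount (M ＼ ({e} : Set α)) k p + extCount (M ＼ ({e} : Set α)) (k - 1) p := by
  have hp' : p ∈ gr (M ＼ ({e} : Set α)) := by rw [gr_delete']; exact mem_erase.2 ⟨hpe, hp⟩
  have h1 := filter_biIndepSets_notMem_coloop he hec k
  have h2 := filter_biIndepSets_notMem_coloop he hec (k + 1)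
  unfold extCount
  rw [← card_filter_add_card_filter_not
    (s := (biIndepSets M k).filter (fun X => p ∉ X ∧ insert p X ∈ biIndepSets M (k + 1))) (fun X => e ∉ X)]
  congr 1
  · -- the `e`-avoiding part is the extension count of `M ∖ e` at level `k`
    congr 1
    ext X
    simp only [mem_filter]
    constructor
    · rintro ⟨⟨hX, hpX, hins⟩, heX⟩
      refine ⟨?_, hpX, ?_⟩
      · rw [← h1, mem_filter]; exact ⟨hX, heX⟩
      · rw [← h2, mem_filter]
        refine ⟨hins, ?_⟩
        simp only [mem_insert, not_or]
        exact ⟨fun h => hpe h.symm, heX⟩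
    · rintro ⟨hX, hpX, hins⟩
      rw [← h1, mem_filter] at hX
      rw [← h2, mem_filter] at hins
      exact ⟨⟨hX.1, hpX, hins.1⟩, hX.2⟩
  · -- the part through `e`: `X ↦ X ∖ e`
    apply card_bij (fun X _ => X.erase e)
    · intro X hX
      simp only [mem_filter, not_not] at hX
      obtain ⟨⟨hX, hpX, hins⟩, heX⟩ := hX
      have hXg : X ⊆ gr M := (mem_biIndepSets.1 hX).1
      have hX' := erase_mem_biIndepSets_delete_of_coloop he hec hX heX
      have hpX' : p ∉ X.erase e := fun h => hpX (mem_of_mem_erase h)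
      rw [mem_filter]
      refine ⟨hX', hpX', ?_⟩
      rw [insert_mem_biIndepSets_iff hX' hp' hpX', mem_clF_delete_iff hp hpe (erase_subset_erase e hXg)]
      rw [insert_mem_biIndepSets_iff hX hp hpX, ← insert_erase heX,
        mem_clF_insert_coloop_iff he hec hp hpe ((erase_subset _ _).trans hXg) (notMem_erase e X)] at hins
      exact hins
    · intro X hX Y hY h
      simp only [mem_filter, not_not] at hX hY
      rw [← insert_erase hX.2, ← insert_erase hY.2, h]
    · intro Y hY
      rw [mem_filter] at hY
      obtain ⟨hY, hpY, hins⟩ := hY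
      have hYg' : Y ⊆ (gr M).erase e := by
        have h := (mem_biIndepSets.1 hY).1
        rwa [gr_delete'] at h
      have heY : e ∉ Y := fun h => (mem_erase.1 (hYg' h)).1 rfl
      have hYg : Y ⊆ gr M := hYg'.trans (erase_subset _ _)
      have hY' := insert_mem_biIndepSets_of_coloop he hec hk hY
      have hpY' : p ∉ insert e Y := by
        simp only [mem_insert, not_or]
        exact ⟨hpe, hpY⟩
      refine ⟨insert e Y, ?_, erase_insert heY⟩
      simp only [mem_filter, not_not]
      refine ⟨⟨hY', hpY', ?_⟩, mem_insert_self e Y⟩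
      rw [insert_mem_biIndepSets_iff hY' hp hpY', mem_clF_insert_coloop_iff he hec hp hpe hYg heY,
        ← mem_clF_delete_iff hp hpe hYg', ← insert_mem_biIndepSets_iff hY hp' hpY]
      exact hins

/-! ### Level `0` -/

/-- Level `0`: `c^p_0 = P_0` for every point `p` — the empty set extends by any point when the ground set is
independent (and `P_0 = 0` otherwise). -/
theorem extCount_zero {p : α} (hp : p ∈ gr M) : extCount M 0 p = (biIndepSets M 0).card := by
  unfold extCount
  apply le_antisymm (card_filter_le _ _)
  apply card_le_card
  intro X hX
  have hX0 := mem_biIndepSets.1 hX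
  obtain ⟨-, hXk, -, hXc⟩ := hX0
  have hXe : X = ∅ := card_eq_zero.1 hXk
  subst hXe
  have hpX : p ∉ (∅ : Finset α) := notMem_empty p
  rw [mem_filter]
  refine ⟨hX, hpX, ?_⟩
  rw [insert_mem_biIndepSets_iff hX hp hpX, mem_clF_iff_rk_insert_eq hp (empty_subset _)]
  have h1 : rk M (insert p (∅ : Finset α)) = (insert p (∅ : Finset α)).card := by
    apply rk_eq_card_of_subset_of_rk_eq_card (Y := gr M \ ∅) _ hXc
    rw [sdiff_empty]
    exact insert_subset hp (empty_subset _)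
  have h0 : rk M ∅ = (∅ : Finset α).card := rk_eq_card_of_subset_of_rk_eq_card (empty_subset _) hXc
  rw [h1, h0, card_insert_of_notMem hpX, card_empty]
  omega

/-! ### (Ĉ) is closed under adding a coloop -/

/-- **(Ĉ) AT `(M, p, k)` FROM (Ĉ) AT `(M ∖ e, p, k − 1)` AND `(M ∖ e, p, k)`**, for a coloop `e ≠ p` (the
level-`k` instance of `M ∖ e` is needed only inside its own window `2k + 2 ≤ N − 1`; at the boundary `2k + 2 = N`
the symmetry `P_k(M ∖ e) = P_{k+1}(M ∖ e)` replaces it).  CONDITIONAL on the named fact, through the monotonicity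
`c^p_{k−1}(M ∖ e) ≤ c^p_k(M ∖ e)` (`extCount_mono_of_fact`); the splits `P_k(M) = P_k(M ∖ e) + P_{k−1}(M ∖ e)`
and `c^p_k(M) = c^p_k(M ∖ e) + c^p_{k−1}(M ∖ e)` are unconditional. -/
theorem pointedRow_of_delete_coloop_of_fact (hfact : BiIndepDensityLogConcave α) (M : Matroid α) [M.Finite]
    {p e : α} (hp : p ∈ gr M) (he : e ∈ gr M) (hpe : p ≠ e)
    (hec : rk M ((gr M).erase e) + 1 = rk M (gr M)) (k : ℕ) (hk : 2 * k + 2 ≤ (gr M).card)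
    (h1 : 1 ≤ k →
      ((gr (M ＼ ({e} : Set α))).card - (k - 1) - 1) * (biIndepSets (M ＼ ({e} : Set α)) (k - 1)).card ≤
        (k - 1) * (biIndepSets (M ＼ ({e} : Set α)) (k - 1 + 1)).card +
          ((gr (M ＼ ({e} : Set α))).card - 2 * (k - 1) - 1) * extCount (M ＼ ({e} : Set α)) (k - 1) p)
    (h2 : 2 * k + 2 ≤ (gr (M ＼ ({e} : Set α))).card →
      ((gr (M ＼ ({e} : Set α))).card - k - 1) * (biIndepSets (M ＼ ({e} : Set α)) k).card ≤
        k * (biIndepSets (M ＼ ({e} : Set α)) (k + 1)).card +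
          ((gr (M ＼ ({e} : Set α))).card - 2 * k - 1) * extCount (M ＼ ({e} : Set α)) k p) :
    ((gr M).card - k - 1) * (biIndepSets M k).card ≤
      k * (biIndepSets M (k + 1)).card + ((gr M).card - 2 * k - 1) * extCount M k p := by
  have hN : (gr (M ＼ ({e} : Set α))).card = (gr M).card - 1 := by
    rw [gr_delete', card_erase_of_mem he]
  rcases Nat.eq_zero_or_pos k with rfl | hk1
  · rw [extCount_zero hp]
    simp only [zero_mul, zero_add, Nat.sub_zero, Nat.mul_zero, le_refl]
  · obtain ⟨j, rfl⟩ : ∃ j, k = j + 1 := ⟨k - 1, by omega⟩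
    have hp' : p ∈ gr (M ＼ ({e} : Set α)) := by rw [gr_delete']; exact mem_erase.2 ⟨hpe, hp⟩
    have hmono := extCount_mono_of_fact hfact (M ＼ ({e} : Set α)) hp' j (by rw [hN]; omega)
    have h1' := h1 hk1
    rw [show j + 1 - 1 = j by omega] at h1'
    rw [card_biIndepSets_coloop he hec hk1, card_biIndepSets_coloop he hec (by omega : 1 ≤ j + 1 + 1),
      show j + 1 + 1 - 1 = j + 1 by omega, extCount_delete_coloop he hec hp hpe hk1,
      show j + 1 - 1 = j by omega]
    obtain ⟨m, hm⟩ := Nat.exists_eq_add_of_le hk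
    rw [hN, hm] at h1' h2
    rw [hm]
    rw [show 2 * (j + 1) + 2 + m - (j + 1) - 1 = j + 2 + m by omega,
      show 2 * (j + 1) + 2 + m - 2 * (j + 1) - 1 = m + 1 by omega]
    rw [show 2 * (j + 1) + 2 + m - 1 - j - 1 = j + 2 + m by omega,
      show 2 * (j + 1) + 2 + m - 1 - 2 * j - 1 = m + 2 by omega] at h1'
    rcases Nat.eq_zero_or_pos m with rfl | hm1
    · -- the boundary `2k + 2 = N`: `M ∖ e` has `2k + 1` elements, `P_{k+1}(M ∖ e) = P_k(M ∖ e)`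
      have hs := card_biIndepSets_symm (M ＼ ({e} : Set α)) (k := j + 1) (by rw [hN, hm]; omega)
      rw [hN, hm, show 2 * (j + 1) + 2 + 0 - 1 - (j + 1) = j + 1 + 1 by omega] at hs
      rw [← hs]
      generalize (biIndepSets (M ＼ ({e} : Set α)) j).card = Q0 at h1' ⊢
      generalize (biIndepSets (M ＼ ({e} : Set α)) (j + 1)).card = Q1 at h1' ⊢
      generalize extCount (M ＼ ({e} : Set α)) j p = c0 at h1' hmono ⊢
      generalize extCount (M ＼ ({e} : Set α)) (j + 1) p = c1 at hmono ⊢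
      nlinarith [h1', hmono]
    · have h2' := h2 (by omega)
      rw [show 2 * (j + 1) + 2 + m - 1 - (j + 1) - 1 = j + 1 + m by omega,
        show 2 * (j + 1) + 2 + m - 1 - 2 * (j + 1) - 1 = m by omega] at h2'
      generalize (biIndepSets (M ＼ ({e} : Set α)) j).card = Q0 at h1' ⊢
      generalize (biIndepSets (M ＼ ({e} : Set α)) (j + 1)).card = Q1 at h1' h2' ⊢
      generalize (biIndepSets (M ＼ ({e} : Set α)) (j + 1 + 1)).card = Q2 at h2' ⊢
      generalize extCount (M ＼ ({e} : Set α)) j p = c0 at h1' hmono ⊢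
      generalize extCount (M ＼ ({e} : Set α)) (j + 1) p = c1 at h2' hmono ⊢
      nlinarith [h1', h2', hmono]

/-- (Ĉ) at every level of one pointed matroid `(M, p)`, as a predicate (the body of `PointedRow` at `(M, p)`). -/
def PointedRowAt (M : Matroid α) [M.Finite] (p : α) : Prop :=
  ∀ k : ℕ, 2 * k + 2 ≤ (gr M).card →
    ((gr M).card - k - 1) * (biIndepSets M k).card ≤
      k * (biIndepSets M (k + 1)).card + ((gr M).card - 2 * k - 1) * extCount M k p

/-- `PointedRow α` is exactly `PointedRowAt` at every pointed matroid on `α`. -/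
theorem pointedRow_iff_forall_pointedRowAt :
    PointedRow α ↔ ∀ (M : Matroid α) [M.Finite] (p : α), p ∈ gr M → PointedRowAt M p := by
  constructor
  · intro h M _ p hp k hk
    exact h M p k hp hk
  · intro h M _ p k hp hk
    exact h M p hp k hk

/-- **(Ĉ) IS CLOSED UNDER ADDING A COLOOP** (CONDITIONAL on the named fact): for a coloop `e ≠ p` of `M`, (Ĉ) at
every level of `(M ∖ e, p)` gives (Ĉ) at every level of `(M, p)`. -/
theorem pointedRowAt_of_delete_coloop_of_fact (hfact : BiIndepDensityLogConcave α) (M : Matroid α) [M.Finite]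
    {p e : α} (hp : p ∈ gr M) (he : e ∈ gr M) (hpe : p ≠ e)
    (hec : rk M ((gr M).erase e) + 1 = rk M (gr M)) (h : PointedRowAt (M ＼ ({e} : Set α)) p) :
    PointedRowAt M p := by
  intro k hk
  refine pointedRow_of_delete_coloop_of_fact hfact M hp he hpe hec k hk (fun hk1 => h (k - 1) ?_)
    (fun hk2 => h k hk2)
  rw [gr_delete', card_erase_of_mem he]
  omega

/-- **MINIMAL (Ĉ)-WITNESSES ARE COLOOP-FREE AWAY FROM `p`** (CONDITIONAL on the named fact): a failure of (Ĉ) at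
`(M, p)` with a coloop `e ≠ p` is already a failure at `(M ∖ e, p)`. -/
theorem not_pointedRowAt_delete_coloop_of_fact (hfact : BiIndepDensityLogConcave α) (M : Matroid α) [M.Finite]
    {p e : α} (hp : p ∈ gr M) (he : e ∈ gr M) (hpe : p ≠ e)
    (hec : rk M ((gr M).erase e) + 1 = rk M (gr M)) (h : ¬ PointedRowAt M p) :
    ¬ PointedRowAt (M ＼ ({e} : Set α)) p :=
  fun h' => h (pointedRowAt_of_delete_coloop_of_fact hfact M hp he hpe hec h')

/-- **AND `p` ITSELF IS NO COLOOP OF A WITNESS** (CONDITIONAL on the named fact): at a coloop `p`, (Ĉ) holds at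
every level (`pointedRow_coloop_of_fact`, gen 13, restated on `PointedRowAt`). -/
theorem pointedRowAt_coloop_of_fact (hfact : BiIndepDensityLogConcave α) (M : Matroid α) [M.Finite] {p : α}
    (hp : p ∈ gr M) (hpc : rk M ((gr M).erase p) + 1 = rk M (gr M)) : PointedRowAt M p :=
  fun k hk => pointedRow_coloop_of_fact hfact M hp hpc k hk

end PercRepro.Cogirth
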